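import Literature.Computability.QuantumComplexity.ForrelationDerivativeTables

/-!
# Crux `CubicForrelation.NearExactIsExact` (stmt-QuantumAdvantage-14043), line `direct-sum-amplification` —
stub CC: Carlet's criterion for the dual of a sum of three bent functions

For bent `g₁ g₂ g₃` on `m + m` bits with dual signs `d₁ d₂ d₃` (bentness with its dual in the form
`W_{gᵢ}(x) = 2^m (−1)^{dᵢ(x)}`, `W_g(x) = Σ_y (−1)^{g(y)} (−1)^{y·x}` the unnormalised Walsh transform) and
`g₁ ⊕ g₂ ⊕ g₃` bent with dual sign `d₄`: the dual of the sum is the sum of the duals, `d₄ = d₁ ⊕ d₂ ⊕ d₃`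
everywhere, iff the majority `g₁g₂ ⊕ g₁g₃ ⊕ g₂g₃` is bent (`W_{maj}(x)² = 2^{m+m}` for all `x`) —
`stub_carletCriterion`.

Proof (entirely pointwise plus linearity of `W`). On `{±1}`,
`(−1)^{ab ⊕ ac ⊕ bc} = (σ_a + σ_b + σ_c − σ_a σ_b σ_c)/2` (`crl_signOf_maj`, 8 cases) and
`(−1)^{a ⊕ b ⊕ c} = σ_a σ_b σ_c` (`crl_signOf_xor₃`), so by linearity of the finite sum `W`
(`crl_W_maj`) `W_{maj} = (W₁ + W₂ + W₃ − W_{123})/2 = 2^m (δ₁ + δ₂ + δ₃ − δ₄)/2` with `δᵢ = (−1)^{dᵢ(x)}`.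
Hence `W_{maj}(x)² = 2^{m+m} ↔ (δ₁ + δ₂ + δ₃ − δ₄)² = 4` (`crl_scale_iff`, cancelling `4^m/4 > 0`), and on
`{±1}` the latter says exactly `δ₄ = δ₁ δ₂ δ₃` (`crl_sq_eq_four_iff`, 16 cases). Assemble with `forall_congr'`.

Sources: C. Carlet, *Boolean Functions for Cryptography and Coding Theory*, CUP 2021, §6.1.16, Prop. 85
(Relation (6.30): `W_{f₁} + W_{f₂} + W_{f₃} = W_{s₁} + 2 W_{s₂}`) and Cor. 15 (there attributed to C. Carlet,
*On bent and highly nonlinear balanced/resilient functions and their algebraic immunities*, AAECC-16, LNCS 3857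
(2006)); the `iff` form is S. Mesnager, *Several new infinite families of bent functions and their duals*,
IEEE Trans. Inform. Theory 60 (2014), Thm. 4. Everything below is proved from Mathlib and the tree definitions
(`DerivativeWalsh.W`, `signOf`, `twist`); axioms are the standard three.
-/

set_option linter.dupNamespace false -- D-0017: single-problem summit ⇒ `QuantumAdvantage.QuantumAdvantage` by design

noncomputable section

namespace Summit.QuantumAdvantage.QuantumAdvantage.Theorems.CubicForrelation.NearExactIsExact

open Finset
open Literature.Computability.QuantumComplexity
open Literature.Computability.QuantumComplexity.DerivativeWalsh (W)

variable {n : ℕ}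

/-! ### Pointwise sign identities -/

/-- The sign of the majority of three bits: `(−1)^{ab ⊕ ac ⊕ bc} = (σ_a + σ_b + σ_c − σ_a σ_b σ_c)/2`
with `σ = (−1)^{·}` (8 cases). -/
theorem crl_signOf_maj (a b c : Bool) :
    signOf ((a && b) ^^ (a && c) ^^ (b && c)) =
      (signOf a + signOf b + signOf c - signOf a * signOf b * signOf c) / 2 := by
  cases a <;> cases b <;> cases c <;> simp [signOf] <;> norm_num

/-- The sign of a triple XOR is the product of the signs: `(−1)^{a ⊕ b ⊕ c} = σ_a σ_b σ_c`. -/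
theorem crl_signOf_xor₃ (a b c : Bool) : signOf (a ^^ b ^^ c) = signOf a * signOf b * signOf c := by
  cases a <;> cases b <;> cases c <;> simp [signOf]

/-! ### Linearity of `W`: the Walsh transform of the majority -/

/-- `W_{g₁g₂ ⊕ g₁g₃ ⊕ g₂g₃} = (W_{g₁} + W_{g₂} + W_{g₃} − W_{g₁ ⊕ g₂ ⊕ g₃})/2` pointwise
(linearity of the finite sum `W f x = Σ_y f(y) (−1)^{y·x}` and `crl_signOf_maj`, `crl_signOf_xor₃`). -/
theorem crl_W_maj (g₁ g₂ g₃ : (Fin n → Bool) → Bool) (x : Fin n → Bool) :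
    W (fun y => signOf ((g₁ y && g₂ y) ^^ (g₁ y && g₃ y) ^^ (g₂ y && g₃ y))) x =
      (W (fun y => signOf (g₁ y)) x + W (fun y => signOf (g₂ y)) x + W (fun y => signOf (g₃ y)) x -
        W (fun y => signOf (g₁ y ^^ g₂ y ^^ g₃ y)) x) / 2 := by
  unfold W
  rw [← sum_add_distrib, ← sum_add_distrib, ← sum_sub_distrib, sum_div]
  refine sum_congr rfl fun y _ => ?_
  dsimp only
  rw [crl_signOf_maj, crl_signOf_xor₃]
  ring

/-! ### The two real-arithmetic steps -/

/-- Cancelling the positive factor: `(c t / 2)² = c·c ↔ t² = 4` for `c ≠ 0`. -/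
theorem crl_scale_iff (c t : ℝ) (hc : c ≠ 0) : (c * t / 2) ^ 2 = c * c ↔ t ^ 2 = 4 := by
  constructor
  · intro h
    have h' : c * c * (t ^ 2 - 4) = 0 := by linear_combination 4 * h
    rcases mul_eq_zero.1 h' with h'' | h''
    · exact absurd h'' (mul_ne_zero hc hc)
    · linarith
  · intro h
    linear_combination (c * c / 4) * h

/-- On `{±1}`: `(δ₁ + δ₂ + δ₃ − δ₄)² = 4 ↔ δ₄ = δ₁ δ₂ δ₃`, i.e. `d₄ = d₁ ⊕ d₂ ⊕ d₃` (16 cases). -/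
theorem crl_sq_eq_four_iff (d₁ d₂ d₃ d₄ : Bool) :
    (signOf d₁ + signOf d₂ + signOf d₃ - signOf d₄) ^ 2 = 4 ↔ d₄ = (d₁ ^^ d₂ ^^ d₃) := by
  cases d₁ <;> cases d₂ <;> cases d₃ <;> cases d₄ <;> simp [signOf] <;> norm_num

/-! ### The stub -/

/-- **stub_carletCriterion** (CC; Carlet's criterion). [cite: Carlet2020, §6.1.16, Prop. 85 (Relation (6.30)) and
Cor. 15] For bent `g₁ g₂ g₃` on `m + m` bits with dual signs `d₁ d₂ d₃` (`W_{gᵢ} = 2^m (−1)^{dᵢ}`) and `g₁ ⊕ g₂ ⊕ g₃` bent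
with dual sign `d₄`: `d₄ = d₁ ⊕ d₂ ⊕ d₃` everywhere iff the majority `g₁g₂ ⊕ g₁g₃ ⊕ g₂g₃` is bent
(`W_{maj}(x)² = 2^{m+m}` for all `x`). Proof: `W_{maj} = 2^m (δ₁ + δ₂ + δ₃ − δ₄)/2` pointwise (`crl_W_maj` and the
four hypotheses), then `crl_scale_iff` and `crl_sq_eq_four_iff`, assembled by `forall_congr'`. -/
theorem stub_carletCriterion :
    ∀ (m : ℕ) (g₁ g₂ g₃ d₁ d₂ d₃ d₄ : (Fin (m + m) → Bool) → Bool),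
      (∀ x, W (fun y => signOf (g₁ y)) x = (2 : ℝ) ^ m * signOf (d₁ x)) →
      (∀ x, W (fun y => signOf (g₂ y)) x = (2 : ℝ) ^ m * signOf (d₂ x)) →
      (∀ x, W (fun y => signOf (g₃ y)) x = (2 : ℝ) ^ m * signOf (d₃ x)) →
      (∀ x, W (fun y => signOf (g₁ y ^^ g₂ y ^^ g₃ y)) x = (2 : ℝ) ^ m * signOf (d₄ x)) →
      ((∀ x, d₄ x = (d₁ x ^^ d₂ x ^^ d₃ x)) ↔
        ∀ x, W (fun y => signOf ((g₁ y && g₂ y) ^^ (g₁ y && g₃ y) ^^ (g₂ y && g₃ y))) x ^ 2 = (2 : ℝ) ^ (m + m)) := by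
  intro m g₁ g₂ g₃ d₁ d₂ d₃ d₄ h₁ h₂ h₃ h₄
  refine forall_congr' fun x => ?_
  have hW : W (fun y => signOf ((g₁ y && g₂ y) ^^ (g₁ y && g₃ y) ^^ (g₂ y && g₃ y))) x =
      (2 : ℝ) ^ m * (signOf (d₁ x) + signOf (d₂ x) + signOf (d₃ x) - signOf (d₄ x)) / 2 := by
    rw [crl_W_maj, h₁ x, h₂ x, h₃ x, h₄ x]
    ring
  rw [hW, pow_add, crl_scale_iff _ _ (by positivity), crl_sq_eq_four_iff]

end Summit.QuantumAdvantage.QuantumAdvantage.Theorems.CubicForrelation.NearExactIsExact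

end
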